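import Summits.BirchSwinnertonDyer.BirchSwinnertonDyer.Theorems.SchneiderFreeAdditiveX3GenusCharacterValues
import Literature.NumberTheory.EllipticCurves.ArtinFormalismSemistableLocalProofs
import Literature.NumberTheory.EllipticCurves.BSDQuadraticDescentProofs
import Literature.NumberTheory.EllipticCurves.QuadraticTwistLFunctionProofs
import Literature.NumberTheory.EllipticCurves.ModularityVersionApProofs
import Literature.NumberTheory.EllipticCurves.LFunctionSmulProofs
import Literature.NumberTheory.EllipticCurves.Gross2004.RationalCharacterLSeries
import Literature.NumberTheory.GaloisRepresentations.HeckeCharacterProofs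
import Literature.NumberTheory.QuadraticFields.JacobiCharacter
import Summits.BirchSwinnertonDyer.Rank1Residual.Additive.GordTwistMinimalModel
import Mathlib.NumberTheory.GaussSum
import HarnessLib

/-!
# Route `SchneiderFreeAdditiveX3` (K1 door), cruxes `PotMultBranchIMC` / `GordTwoBranchIMC`
# (items stmt-BirchSwinnertonDyer-19176 / 19177): the ARTIN LINK for the genus character — FILE 3a
# (local factors in Galois currency; the `ℓ`-local polynomials of `W = C • (V ⊗ χ_{p*})`)

Cell `bsd-schneider-ideate`, seat `bsd-schneider-door-c4` (prover, generation 8). HONEST FRAMING: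
theorems only (no definition, no named fact, nothing asserted about BSD; both cruxes stay OPEN).
FILE 3a of W2 (§1–§2 here; §3–§4 in `…ArtinLinkGenus.lean`; after `…GaloisHeckeValues.lean`, `…GenusCharacterValues.lean`).

The layer-2 value road of both door cells evaluates Cai–Shu–Tian's explicit Gross–Zagier formula
(Thm 1.1 on (G), door-c3; Thm 1.5 on (M), door-c2 g8) at the genus character `χ` of conductor `p`;
its left-hand side is `rankinSelbergDerivValue Dt_V.f χ_gal 1`, the derivative at `s = 1` of the
continued Rankin–Selberg `L`-function of `f_V` over `K` twisted by `χ_gal` in the tree's GALOIS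
currency (`rankinSelbergEulerProduct`, Nekovář (0.5)), and the road needs the ARTIN LINK
`rankinSelbergDerivValue Dt_V.f χ_gal 1 = LDerivEK W K` (= `(L(W,·)·L(W^{(d_K)},·))′(1)`) for the
door's curve `W = C • (V ⊗ χ_{p*})`. On (G) door-c3 derived it from the CITE-ONLY fact
`Gross2004.rankinLSeries_eq_mul_quadraticTwist` (Gross 2004 §2: `L(f, χ, s) = L(A₁, s)L(A₂, s)`,
vendored WITH Gross's standing hypothesis `(c, N) = 1`); on (M) that fact does not apply
(`c = p ∥ N_V`) and door-c2 g8 carries `hArtin` as a hypothesis (FINDING-door-c2-g8 §2, want W2).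
This file PROVES the link, for both cells, from tree theorems only:

* §1 the Rankin–Selberg local factor (Galois currency) at a place of residue degree `d`, and its
  eigenvalue form `(1 − (εα₀)^d T)(1 − (εβ₀)^d T)` when `heckeValueAt χ v = ε^d`;
* §2 over `ℚ`: for every prime `ℓ`, `L_ℓ(W, T) = 1 − tT + δT²` with `t = (ℓ/p)·a_ℓ(f_V)`,
  `δ = (ℓ/p)²·ℓ𝟙_{ℓ∤N_V}` (`exists_localPolynomialAt_eq_of_twist_pStar`: `a_ℓ(E ⊗ χ_{p*}) = (ℓ/p)a_ℓ(E)`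
  by the tree's `LFunction_quadraticTwist_pStar_apply`; `a_ℓ = −[T¹]L_ℓ` at EVERY prime,
  `LFunction_primesEquiv_eq_neg_coeff_one`; `[T²]L_ℓ = ℓ·𝟙[good]`; bad primes away from `p` agree
  by `conductorExponent_eq_of_twist_pStar_of_ne` + `factorization_conductorNorm` + `dvd_conductorNorm_iff`;
  at `ℓ = p` both sides are `1`);
* §3 place by place over `K` (`rankinSelbergLocalFactorInv_genus_eq_localPolynomialAt`):
  `F_w(s) = L_w(W_K, N w^{−s})` — base change raises the Frobenius eigenvalues to the `f(w|ℓ)`-th power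
  at places unramified in `K` for ANY reduction type and at ramified places of semistable reduction
  (tree `map_localPolynomialAt_baseChange_eq_of_ramificationIdxIn_eq_one` / `…_of_isSemistableAt`,
  `ArtinFormalismSemistableLocalProofs`), and the genus character has the value `(ℓ/p)^{f(w|ℓ)}` at
  EVERY `w` (FILE 2; `0 = (p/p)^f` above `p`);
* §4 `rankinSelbergEulerProduct f χ_gal s = L(W_K, s) = L(W, s)·L(W^{(d_K)}, s)` on `re s > 3/2`
  (tree `hasProd_localPolynomialAt_inv_LSeries` — the curve-side Euler product converges there by the
  Hasse bound, which is why the Galois road and not the Hecke-currency Artin formalism (proved only on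
  `re s > 2`) is used — and `LSeries_baseChange_quadratic_holds`), whence by continuation
  **`artinLink_genus : rankinSelbergDerivValue f χ_gal 1 = LDerivEK W K`** and its form from the
  modularity fact `hasEntireLFunction_rat`.

Hypotheses of `artinLink_genus` (all met on the door, see the companion `…ArtinLinkGenusDoor.lean`):
`p` odd; `V`, `W` globally minimal, `C • (V ⊗ χ_{p*}) = W`, `W` ADDITIVE at `p` (the door's `Addv`);
`f` with `IsNewformOf V f` at level `N_V`; `K` quadratic Galois with ONE prime over `p` of
ramification index `1` (the frame's degree-one `𝔭`) and, at every rational prime, `K` unramified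
OR `W` semistable (Heegner hypothesis: the primes of `N_W` split); `χ_gal` rational for `p*`
(the genus datum, `isRationalCharacterFor_of_genusDatum`); `L(W,s)`, `L(W^{(d_K)},s)` entire.

References: Gross, MSRI Publ. 49 (2004) §2 p. 40, §13 p. 49; Nekovář, Math. Ann. 302 (1995)
(0.5); Silverman *AEC* V.2.3.1, X.2, Ex. 10.16, App. C §16; Ireland–Rosen Prop. 20.5.4 (b);
Diamond–Shurman §8.3; Neukirch I §8–§9.
-/

noncomputable section

open scoped NumberField NumberTheorySymbols Classical
open Field IsDedekindDomain NumberField Polynomial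
open Literature.NumberTheory.GaloisRepresentations
open Literature.NumberTheory.EllipticCurves.ModularForms

-- D-0017 layout: summit = sub-problem, so `Summit.BirchSwinnertonDyer.BirchSwinnertonDyer.…` is the
-- mandated namespace (same option as the route's sockets files).
set_option linter.dupNamespace false
set_option autoImplicit false

namespace Summit.BirchSwinnertonDyer.BirchSwinnertonDyer.Theorems.SchneiderFree

open Literature.NumberTheory.EllipticCurves

/-! ## §1 The Rankin–Selberg local factor (Galois currency) at a place of residue degree `d` -/

section LocalFactor

variable {K : Type} [Field K] [NumberField K] {N : ℕ}

/-- `(p^d)^{s} = (p^{s})^d` for natural `p`, `d`. [folklore] -/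
private theorem natCast_pow_cpow (p d : ℕ) (s : ℂ) :
    (((p ^ d : ℕ) : ℂ)) ^ s = (((p : ℕ) : ℂ) ^ s) ^ d := by
  induction d with
  | zero => rw [pow_zero, pow_zero, Nat.cast_one, Complex.one_cpow]
  | succ d ih => rw [pow_succ, Nat.cast_mul, Complex.natCast_mul_natCast_cpow, ih, pow_succ]

/-- **The Rankin–Selberg local factor (GALOIS currency) at a place of residue degree `d` over `p`**:
if `N(v) = p^d` (`p` prime, `d ≥ 1`) then, with `w = heckeValueAt χ v`, `X = p^{−s}`,
`e = p·𝟙_{p ∤ N}`: `F_v(s) = 1 − (α^d + β^d) w X^d + e^d w² X^{2d}` — verbatim the tree's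
`rankinSelbergLocalFactorInvHecke_of_absNorm_eq_pow` for the finite-order definition.
[cite: Nekovar1995, (0.5) p. 611 and §3.4] -/
theorem rankinSelbergLocalFactorInv_of_absNorm_eq_pow (f : CuspForm (CongruenceSubgroup.Gamma0 N) 2)
    (χ : absoluteGaloisGroup K →ₜ* ℂˣ) {v : HeightOneSpectrum (𝓞 K)} {p d : ℕ} (hp : p.Prime)
    (hd : d ≠ 0) (hv : Ideal.absNorm v.asIdeal = p ^ d) (s : ℂ) :
    rankinSelbergLocalFactorInv f χ v s =
      1 - frobTracePow (cuspCoeff f p) (if p ∣ N then 0 else (p : ℂ)) d * heckeValueAt χ v *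
          ((p : ℂ) ^ (-s)) ^ d +
        (if p ∣ N then 0 else (p : ℂ)) ^ d * heckeValueAt χ v ^ 2 * (((p : ℂ) ^ (-s)) ^ d) ^ 2 := by
  have hmin : (p ^ d).minFac = p := by rw [Nat.pow_minFac hd, hp.minFac_eq]
  have hfac : (p ^ d).factorization p = d := by
    rw [Nat.factorization_pow, Finsupp.smul_apply, hp.factorization_self, smul_eq_mul, mul_one]
  have h2s : (((p ^ d : ℕ) : ℂ)) ^ (-2 * s) = ((((p : ℕ) : ℂ) ^ (-s)) ^ d) ^ 2 := by
    rw [show (-2 * s : ℂ) = ((2 : ℕ) : ℂ) * (-s) by push_cast; ring, Complex.cpow_nat_mul,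
      natCast_pow_cpow]
  have h1s : (((p ^ d : ℕ) : ℂ)) ^ (-s) = (((p : ℕ) : ℂ) ^ (-s)) ^ d := natCast_pow_cpow p d (-s)
  simp only [rankinSelbergLocalFactorInv, hv, hmin, hfac]
  rw [h1s, h2s]

/-- **Eigenvalue form of the local factor.** If `α₀ + β₀ = a_p(f)`, `α₀β₀ = e` and the value
`w = heckeValueAt χ v` at a place with `N(v) = p^d` is `ε^d`, then
`F_v(s) = (1 − (εα₀)^d T)(1 − (εβ₀)^d T)` with `T = N(v)^{−s}`. [folklore] -/
theorem rankinSelbergLocalFactorInv_eq_mul_of_eigen (f : CuspForm (CongruenceSubgroup.Gamma0 N) 2)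
    (χ : absoluteGaloisGroup K →ₜ* ℂˣ) {v : HeightOneSpectrum (𝓞 K)} {p d : ℕ} (hp : p.Prime)
    (hd : d ≠ 0) (hv : Ideal.absNorm v.asIdeal = p ^ d) (s : ℂ) {α₀ β₀ ε : ℂ}
    (hadd : α₀ + β₀ = cuspCoeff f p) (hmul : α₀ * β₀ = (if p ∣ N then 0 else (p : ℂ)))
    (hw : heckeValueAt χ v = ε ^ d) :
    rankinSelbergLocalFactorInv f χ v s =
      (1 - (ε * α₀) ^ d * (((v.residueCard : ℂ)) ^ (-s))) *
        (1 - (ε * β₀) ^ d * (((v.residueCard : ℂ)) ^ (-s))) := by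
  rw [rankinSelbergLocalFactorInv_of_absNorm_eq_pow f χ hp hd hv s,
    frobTracePow_eq_pow_add_pow hadd hmul d, hw, ← hmul, HeightOneSpectrum.residueCard, hv,
    Nat.cast_pow, show ((p : ℂ) ^ d) ^ (-s) = (((p ^ d : ℕ) : ℂ)) ^ (-s) by push_cast; rfl,
    natCast_pow_cpow]
  ring

end LocalFactor

/-! ## §2 The local polynomials of `W = C • (V ⊗ χ_{p*})` over `ℚ`: coefficients `((ℓ/p) a_ℓ(f), (ℓ/p)² e_ℓ)` -/

section RatCoefficients

open Rat.HeightOneSpectrum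

/-- The `T²`-coefficient of Mathlib's local polynomial at a place `v` of `ℚ`: `ℓ = N v` at good
reduction, `0` otherwise (`1 − a T + ℓ T²`, `1 ∓ T`, `1`). [cite: SilvermanAEC2009, §C.16 (PDF p. 390)] -/
theorem coeff_two_localPolynomialAt_rat (X : WeierstrassCurve ℚ) [X.IsElliptic]
    (v : HeightOneSpectrum (𝓞 ℚ)) :
    (X.localPolynomialAt v).coeff 2 = if X.HasGoodReductionAt v then ((primesEquiv v : ℕ) : ℤ) else 0 := by
  rcases X.hasGoodReductionAt_or_hasMultiplicativeReductionAt_or_hasAdditiveReductionAt v with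
    hg | hm | ha
  · rw [if_pos hg, X.localPolynomialAt_of_hasGoodReductionAt hg,
      WeierstrassCurve.natCard_residueField_adicCompletionIntegers v]
    simp only [coeff_add, coeff_sub, coeff_one, coeff_C_mul, coeff_X_pow, coeff_X]
    norm_num
  · rw [if_neg hm.not_hasGoodReductionAt]
    by_cases hs : X.HasSplitMultiplicativeReductionAt v
    · rw [X.localPolynomialAt_of_hasSplitMultiplicativeReductionAt hs]
      simp [coeff_X, Polynomial.coeff_one]
    · rw [X.localPolynomialAt_of_hasMultiplicativeReductionAt_of_not_hasSplitMultiplicativeReductionAt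
        hm hs]
      simp [coeff_X, Polynomial.coeff_one]
  · rw [if_neg ha.not_hasGoodReductionAt, X.localPolynomialAt_of_hasAdditiveReductionAt ha]
    simp [Polynomial.coeff_one]

/-- **The `ℓ`-th Dirichlet coefficient is minus the linear coefficient of `L_ℓ(T)`** (Silverman,
*AEC* Ex. 8.19 (a), here at every prime, good or bad): only the place over `ℓ` has residue
cardinality `ℓ`, and `[T¹](1/L_ℓ) = −[T¹] L_ℓ`. [cite: SilvermanAEC2009, Exercise 8.19(a) and §C.16] -/
theorem LFunction_primesEquiv_eq_neg_coeff_one (X : WeierstrassCurve ℚ) [X.IsElliptic]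
    (v : HeightOneSpectrum (𝓞 ℚ)) :
    X.LFunction (primesEquiv v : ℕ) = -(X.localPolynomialAt v).coeff 1 := by
  rw [X.LFunction_apply_prime (primesEquiv v).2, finsum_eq_single _ v fun w hw ↦ ?_]
  · rw [WeierstrassCurve.localEulerFactor_apply_prime _ _ (primesEquiv v).2,
      if_pos (WeierstrassCurve.natCard_residueField_adicCompletionIntegers v),
      WeierstrassCurve.localPowerSeries, PowerSeries.coeff_one_invOfUnit_one, Polynomial.coeff_coe]
  · rw [WeierstrassCurve.localEulerFactor_apply_prime _ _ (primesEquiv v).2, if_neg]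
    rw [WeierstrassCurve.natCard_residueField_adicCompletionIntegers, ← Subtype.ext_iff]
    exact fun h ↦ hw (primesEquiv.injective h)

/-- Coefficients of `1 − C t X + C δ X²`. [folklore] -/
private theorem coeff_quadratic (t δ : ℤ) :
    (1 - C t * X + C δ * X ^ 2 : ℤ[X]).coeff 1 = -t ∧ (1 - C t * X + C δ * X ^ 2 : ℤ[X]).coeff 2 = δ := by
  simp only [coeff_add, coeff_sub, coeff_one, coeff_C_mul, coeff_X_pow, coeff_X]
  norm_num

/-- **The `ℓ`-local polynomial of `W = C • (V ⊗ χ_{p*})` in terms of `V`'s newform.** Let `p` be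
odd, `V`, `W` globally minimal elliptic over `ℚ` with `C • (V ⊗ χ_{p*}) = W`, `W` ADDITIVE at `p`
(e.g. `V` semistable at `p`), and `f` the newform of `V` at level `N = N_V` (`a_n(f) = a_n(V)`). Then
at every prime `ℓ`: `L_ℓ(W, T) = 1 − t T + δ T²` with `t = (ℓ/p)·a_ℓ(f)` and `δ = (ℓ/p)²·e_ℓ`,
`e_ℓ = ℓ·𝟙_{ℓ ∤ N}` — `a_ℓ(E ⊗ χ_{p*}) = (ℓ/p) a_ℓ(E)` for `ℓ ≠ p` (tree
`LFunction_quadraticTwist_pStar_apply`), the reduction type away from `p` is unchanged (conductor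
exponents agree, tree `conductorExponent_eq_of_twist_pStar_of_ne` + `factorization_conductorNorm`
+ `dvd_conductorNorm_iff`), and at `ℓ = p` both sides are `1`, `(p/p) = 0`.
[cite: SilvermanAEC2009, X.2 and Exercise 10.16] [cite: DiamondShurman2005, §8.3 (N_E = ∏ p^{f_p})] -/
theorem exists_localPolynomialAt_eq_of_twist_pStar {p : ℕ} [Fact p.Prime] (hp2 : p ≠ 2)
    (V W : WeierstrassCurve ℚ) [V.IsElliptic] [V.IsGloballyMinimal] [W.IsElliptic]
    [W.IsGloballyMinimal] (Ctw : WeierstrassCurve.VariableChange ℚ)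
    (hC : Ctw • V.quadraticTwist ((-1 : ℚ) ^ (p / 2) * p) = W)
    (hadd : W.HasAdditiveReductionAt ((primesEquiv (R := 𝓞 ℚ)).symm ⟨p, Fact.out⟩))
    {N : ℕ} [NeZero N] {f : CuspForm (CongruenceSubgroup.Gamma0 N) 2} (hf : IsNewformOf V f)
    (hN : N = V.conductorNorm ℤ) (v : HeightOneSpectrum (𝓞 ℚ)) :
    ∃ t δ : ℤ, W.localPolynomialAt v = 1 - C t * X + C δ * X ^ 2 ∧
      (t : ℂ) = (J(((primesEquiv v : ℕ) : ℤ) | p) : ℂ) * cuspCoeff f (primesEquiv v) ∧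
      (δ : ℂ) = (J(((primesEquiv v : ℕ) : ℤ) | p) : ℂ) ^ 2 *
        (if (primesEquiv v : ℕ) ∣ N then 0 else ((primesEquiv v : ℕ) : ℂ)) := by
  have hp : p.Prime := Fact.out
  set ℓ : ℕ := (primesEquiv v : ℕ) with hℓ
  have hℓp : ℓ.Prime := (primesEquiv v).2
  obtain ⟨t, δ, hL⟩ := WeierstrassCurve.exists_localPolynomial_eq_quadratic
    (v.adicCompletionIntegers ℚ) (W.baseChange (v.adicCompletion ℚ))
  have hL' : W.localPolynomialAt v = 1 - C t * X + C δ * X ^ 2 := hL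
  refine ⟨t, δ, hL', ?_, ?_⟩
  -- `t = a_ℓ(W)` and `δ = ℓ·𝟙[W good at ℓ]`
  · have ht : W.LFunction ℓ = t := by
      rw [hℓ, LFunction_primesEquiv_eq_neg_coeff_one W v, hL', (coeff_quadratic t δ).1, neg_neg]
    by_cases hℓeq : ℓ = p
    · -- at `p`: `W` additive, `L_p(W) = 1`, `t = 0 = (p/p)`
      have hv : v = (primesEquiv (R := 𝓞 ℚ)).symm ⟨p, Fact.out⟩ := by
        apply primesEquiv.injective
        rw [Equiv.apply_symm_apply]
        exact Subtype.ext hℓeq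
      have h1 : W.localPolynomialAt v = 1 := W.localPolynomialAt_of_hasAdditiveReductionAt (hv ▸ hadd)
      have ht0 : t = 0 := by
        have h : ((1 : ℤ[X]) - C t * X + C δ * X ^ 2).coeff 1 = (1 : ℤ[X]).coeff 1 :=
          congrArg (fun P : ℤ[X] ↦ P.coeff 1) (hL'.symm.trans h1)
        rw [(coeff_quadratic t δ).1, Polynomial.coeff_one] at h
        simpa using h
      rw [ht0, hℓeq, jacobiSym.mod_left, Int.emod_self, jacobiSym.zero_left hp.one_lt]
      simp
    · -- away from `p`: `a_ℓ(W) = (ℓ/p) a_ℓ(V)`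
      have hndvd : ¬ p ∣ ℓ := fun h ↦ hℓeq ((Nat.prime_dvd_prime_iff_eq hp hℓp).mp h).symm
      obtain ⟨hcast, -⟩ := Summit.BirchSwinnertonDyer.Rank1Residual.Additive.pStar_intCast p
      have hd0 : ((-1 : ℚ) ^ (p / 2) * p) ≠ 0 :=
        mul_ne_zero (pow_ne_zero _ (by norm_num)) (by exact_mod_cast hp.ne_zero)
      haveI := V.isElliptic_quadraticTwist hd0
      have hW : W.LFunction ℓ = legendreSym p ℓ * V.LFunction ℓ := by
        rw [← hC, WeierstrassCurve.LFunction_smul, ← hcast,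
          V.LFunction_quadraticTwist_pStar_apply hp2 hndvd]
      rw [← ht, hW, hf.2 ℓ, jacobiSym.legendreSym.to_jacobiSym]
      push_cast
      ring
  · have hδ : δ = if W.HasGoodReductionAt v then (ℓ : ℤ) else 0 := by
      rw [← (coeff_quadratic t δ).2, ← hL', coeff_two_localPolynomialAt_rat W v]
    by_cases hℓeq : ℓ = p
    · have hv : v = (primesEquiv (R := 𝓞 ℚ)).symm ⟨p, Fact.out⟩ := by
        apply primesEquiv.injective
        rw [Equiv.apply_symm_apply]
        exact Subtype.ext hℓeq
      have hng : ¬ W.HasGoodReductionAt v := (hv ▸ hadd).not_hasGoodReductionAt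
      rw [hδ, if_neg hng, hℓeq, jacobiSym.mod_left, Int.emod_self, jacobiSym.zero_left hp.one_lt]
      simp
    · -- away from `p`: `W` good at `ℓ` iff `ℓ ∤ N_W` iff `ℓ ∤ N_V`, and `(ℓ/p)² = 1`
      haveI : Fact ℓ.Prime := ⟨hℓp⟩
      have hgoodW : W.HasGoodReductionAt v ↔ ¬ ℓ ∣ W.conductorNorm ℤ := by
        rw [W.dvd_conductorNorm_iff v, not_not]
      have hfacW := W.factorization_conductorNorm_holds
        (Summit.BirchSwinnertonDyer.Rank1Residual.Additive.placeOf ℓ)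
      have hfacV := V.factorization_conductorNorm_holds
        (Summit.BirchSwinnertonDyer.Rank1Residual.Additive.placeOf ℓ)
      rw [Summit.BirchSwinnertonDyer.Rank1Residual.Additive.natGenerator_placeOf_eq] at hfacW hfacV
      have hexp := Summit.BirchSwinnertonDyer.Rank1Residual.Additive.conductorExponent_eq_of_twist_pStar_of_ne
        p hp2 V W Ctw hC (Summit.BirchSwinnertonDyer.Rank1Residual.Additive.placeOf ℓ)
        (by rw [Summit.BirchSwinnertonDyer.Rank1Residual.Additive.natGenerator_placeOf_eq]; exact hℓeq)
      have hdvd : ℓ ∣ W.conductorNorm ℤ ↔ ℓ ∣ V.conductorNorm ℤ := by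
        rw [hℓp.dvd_iff_one_le_factorization (W.conductorNorm_pos_holds).ne',
          hℓp.dvd_iff_one_le_factorization (V.conductorNorm_pos_holds).ne', hfacW, hfacV, hexp]
      have hsq : (J((ℓ : ℤ) | p) : ℂ) ^ 2 = 1 := by
        have hcop : Int.gcd (ℓ : ℤ) p = 1 := by
          rw [Int.gcd_natCast_natCast]
          exact (Nat.coprime_primes hℓp hp).mpr hℓeq
        exact_mod_cast jacobiSym.sq_one hcop
      rw [hδ, hsq, one_mul, hN]
      by_cases hg : W.HasGoodReductionAt v
      · rw [if_pos hg, if_neg (hdvd.not.mp (hgoodW.mp hg))]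
        simp
      · rw [if_neg hg, if_pos (hdvd.mp (not_not.mp (hgoodW.not.mp hg)))]
        simp

end RatCoefficients

end Summit.BirchSwinnertonDyer.BirchSwinnertonDyer.Theorems.SchneiderFree

end
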